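import Summits.Ventures.HodgeRepro2.WeilPairing

/-!
# The pairing identity for the Weil vector itself (A3, seat p5)

`WeilPairing.pairing_identity` is stated for `wL P₀ s L` — the Weil factors of `P₀` in the order of
the fixed enumeration `L` of all planes.  The Weil vector `w_σ = weil P₀ s` (`WeilDetect`) has the
same factors in the order of `P₀.toList`.  Reordering a wedge of generators only changes its sign
(`mono_perm`), and the pairing identity is linear in the Weil vector, so it holds VERBATIM for
`weil P₀ s`: `pairing_identity_weil`.  This closes the gap between the two files: the same
`weil P₀ s` enters Lemma A5.6 (`WeilDetect.integral_sum_mul_ET_mul_weil`) and Prop. A5.5.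
-/

open scoped TensorProduct

namespace Summit.Ventures.HodgeRepro2.WeilVector

open Summit.Ventures.HodgeRepro2.WeilPlanes Summit.Ventures.HodgeRepro2.WeilIntegral
  Summit.Ventures.HodgeRepro2.WeilDetect Summit.Ventures.HodgeRepro2.WeilCoproduct
  Summit.Ventures.HodgeRepro2.WeilPairing

variable {ι : Type*} [DecidableEq ι]

/-- A permutation of the generator list changes the monomial by a sign only. -/
theorem mono_perm {l l' : List (Gen ι)} (h : l.Perm l') :
    ∃ ε : ℂ, (ε = 1 ∨ ε = -1) ∧ mono l = ε • mono l' := by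
  induction h with
  | nil => exact ⟨1, Or.inl rfl, by simp⟩
  | cons j _ ih =>
    obtain ⟨ε, hε, h⟩ := ih
    exact ⟨ε, hε, by rw [mono_cons, mono_cons, h, mul_smul_comm]⟩
  | swap j k l =>
    refine ⟨-1, Or.inr rfl, ?_⟩
    rw [mono_cons, mono_cons, mono_cons, mono_cons, ← mul_assoc, ← mul_assoc, gen_mul_gen_swap,
      neg_mul, neg_one_smul]
  | trans _ _ ih₁ ih₂ =>
    obtain ⟨ε₁, hε₁, h₁⟩ := ih₁
    obtain ⟨ε₂, hε₂, h₂⟩ := ih₂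
    refine ⟨ε₁ * ε₂, ?_, by rw [h₁, h₂, smul_smul]⟩
    rcases hε₁ with rfl | rfl <;> rcases hε₂ with rfl | rfl <;> norm_num

variable [Fintype ι]

/-- `wL P₀ s L = ± weil P₀ s` for the full enumeration `L` of the planes. -/
theorem wL_eq_smul_weil (P₀ : Finset ι) (s : Bool) :
    ∃ ε : ℂ, (ε = 1 ∨ ε = -1) ∧
      wL P₀ s (Finset.univ : Finset ι).toList = ε • weil P₀ s := by
  apply mono_perm
  apply List.Perm.map
  apply List.perm_of_nodup_nodup_toFinset_eq
  · exact (Finset.nodup_toList _).filter _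
  · exact Finset.nodup_toList _
  · ext p
    simp

/-- T4-A3 PROPOSITION A5.5 for the Weil vector `w_σ = weil P₀ s` itself, with no sign:
`∫_{B×B} ((z ⊗ θ^{|P₀|}) · Δ(θ^{|I|} ∧ w_σ)) = |I|!·|P₀|!·c_𝒫·vol·∫_B (z ∧ w_σ)`, `I = 𝒫 ∖ P₀`. -/
theorem pairing_identity_weil (P₀ : Finset ι) (s : Bool) (c : ι → ℂ) (z : A ι) :
    II (inl z * inr (theta c ^ P₀.card) * cop (theta c ^ (Finset.univ \ P₀).card * weil P₀ s)) =
      (((Finset.univ \ P₀).card.factorial : ℂ) * (P₀.card.factorial : ℂ) * (∏ p, c p) * vol ι) *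
        integral (z * weil P₀ s) := by
  obtain ⟨ε, hε, h⟩ := wL_eq_smul_weil P₀ s
  have hε0 : ε ≠ 0 := by rcases hε with rfl | rfl <;> norm_num
  have key := pairing_identity P₀ s c z
  rw [h, mul_smul_comm, map_smul, mul_smul_comm, map_smul, mul_smul_comm, map_smul, smul_eq_mul,
    smul_eq_mul] at key
  -- `key : ε * LHS = const * (ε * ∫)`; cancel `ε`
  have : ε * II (inl z * inr (theta c ^ P₀.card) *
      cop (theta c ^ (Finset.univ \ P₀).card * weil P₀ s)) =
      ε * ((((Finset.univ \ P₀).card.factorial : ℂ) * (P₀.card.factorial : ℂ) * (∏ p, c p) * vol ι) *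
        integral (z * weil P₀ s)) := by
    rw [key]; ring
  exact mul_left_cancel₀ hε0 this

end Summit.Ventures.HodgeRepro2.WeilVector
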